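import Summits.AtomisticToContinuum.Crystallization.Theorems.FrustratedLawDichotomyTransportPriceLocal
import Summits.AtomisticToContinuum.Crystallization.Theorems.ContactSaturationLadderWindowFilling

/-!
# FrustratedLawDichotomy · crux `AperiodicFrustratedLawGap` (stmt-AtomisticToContinuum-27623) — LOCALISATION I: THE r⁻⁶ TAIL OF THE ROOT ENERGY
# (decomp-a2c, prover hand 2, structural share, generation 3)

Towards making the deterministic transport-price residuals LOCAL (finite-cluster statements): on a rooted `δ`-hard-core configuration the
Lennard-Jones root energy is its truncation at radius `R ≥ δ` up to an explicit `O(R⁻³)` tail.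

* `setLIntegral_invPow_six_compl_le` — `∫⁻_{‖z‖ > R} ‖z‖⁻⁶ dν ≤ 250·δ⁻³·R⁻³` (the tree's two-scale shell sum
  `ContactSaturationLadderWindowFilling.sum_inv_pow_six_le_two_scale_idx` on every finite subset, then the countable `tsum`);
* `integrable_lennardJones_of_isRootedHardCore` — `z ↦ V_LJ(‖z‖)` is `ν`-integrable;
* `abs_rootEnergy_sub_truncated_le` — **`|rootEnergy V_LJ ν − ½ ∫_{B̄_R(0)} V_LJ(‖z‖) dν| ≤ ½ (δ⁻⁶/12 + 1/6)·250·δ⁻³·R⁻³`**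
  (`enorm_lennardJones_norm_le`: `‖V_LJ(‖z‖)‖ₑ ≤ (δ⁻⁶/12 + 1/6)·‖z‖⁻⁶` for `‖z‖ ≥ δ`).

All `[folklore]`.
-/

noncomputable section

namespace Summit.AtomisticToContinuum.Crystallization.Theorems.FrustratedLawDichotomyTransportPriceTail

open MeasureTheory Metric Set Filter
open scoped ENNReal Topology BigOperators
open Literature.MathematicalPhysics.StatisticalMechanics Literature.Probability.Process
open Summit.AtomisticToContinuum.Crystallization.Theorems.ChargedEnergyGapNegative (E3 eStar)
open Summit.AtomisticToContinuum.Crystallization.Theorems.FrustratedLawDichotomyFiniteClusterGap (measurable_ofReal_lennardJones_parts)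
open Summit.AtomisticToContinuum.Crystallization.Theorems.FrustratedLawDichotomyTransportPriceLocal (rootEnergy_eq_parts)
open Literature.Probability.Process.LocalConfig (finite_inter_of_separated)
open Summit.AtomisticToContinuum.Crystallization.Theorems.ContactSaturationLadderWindowFilling (sum_inv_pow_six_le_two_scale_idx)

variable {δ : ℝ} {ν : Measure E3}

/-- A `δ`-separated set (`δ > 0`) is countable (it meets every ball in a finite set). [folklore] -/
theorem countable_of_separated (hδ : 0 < δ) {S : Set E3} (hsep : ∀ x ∈ S, ∀ y ∈ S, x ≠ y → δ ≤ dist x y) : S.Countable := by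
  have hS : S = ⋃ n : ℕ, (closedBall (0 : E3) n ∩ S) := by
    ext z
    simp only [mem_iUnion, mem_inter_iff, mem_closedBall, dist_zero_right]
    exact ⟨fun hz => ⟨⌈‖z‖⌉₊, Nat.le_ceil _, hz⟩, fun ⟨_, _, hz⟩ => hz⟩
  rw [hS]
  exact countable_iUnion fun n => (finite_inter_of_separated hδ hsep (isCompact_closedBall (0 : E3) n)).countable

/-- **The `r⁻⁶` tail on a hard-core configuration.**  For a rooted `δ`-hard-core `ν` and `R ≥ δ`:
`∫⁻_{‖z‖ > R} ‖z‖⁻⁶ dν ≤ 250·δ⁻³·R⁻³`. [folklore] -/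
theorem setLIntegral_invPow_six_compl_le (hδ : 0 < δ) (hν : IsRootedHardCore δ ν) {R : ℝ} (hR : δ ≤ R) :
    ∫⁻ z in (closedBall (0 : E3) R)ᶜ, ENNReal.ofReal (‖z‖⁻¹ ^ 6) ∂ν ≤ ENNReal.ofReal (250 * δ⁻¹ ^ 3 * R⁻¹ ^ 3) := by
  classical
  obtain ⟨S, -, hsep, rfl⟩ := hν
  have hSc : ((closedBall (0 : E3) R)ᶜ ∩ S).Countable := (countable_of_separated hδ hsep).mono inter_subset_right
  rw [Measure.restrict_restrict (measurableSet_closedBall.compl), lintegral_countable _ hSc]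
  simp only [Measure.count_singleton, mul_one]
  refine ENNReal.summable.tsum_le_of_sum_le fun t => ?_
  -- a finite subset `t` of the far part of `S`
  set t' : Finset E3 := t.map (Function.Embedding.subtype _) with ht'
  have hmem : ∀ z ∈ t', R < ‖z‖ ∧ z ∈ S := fun z hz => by
    obtain ⟨a, -, rfl⟩ := Finset.mem_map.mp hz
    have ha := a.2
    simp only [mem_inter_iff, mem_compl_iff, mem_closedBall, dist_zero_right, not_le] at ha
    exact ha
  have hsum : ∑ a ∈ t, ENNReal.ofReal (‖(a : E3)‖⁻¹ ^ 6) = ∑ z ∈ t', ENNReal.ofReal (‖z‖⁻¹ ^ 6) := by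
    rw [ht', Finset.sum_map]; rfl
  rw [hsum, ← ENNReal.ofReal_sum_of_nonneg (fun z _ => by positivity)]
  refine ENNReal.ofReal_le_ofReal ?_
  -- index the finite set by `Fin t'.card` and apply the tree's two-scale shell bound
  set y : Fin t'.card → E3 := fun k => (t'.equivFin.symm k : E3) with hy
  have hyinj : Function.Injective y := fun k l hkl => t'.equivFin.symm.injective (Subtype.ext hkl)
  have hymem : ∀ k, y k ∈ t' := fun k => (t'.equivFin.symm k).2
  have h2 := sum_inv_pow_six_le_two_scale_idx y Finset.univ (0 : E3) hδ hR
    (fun k _ l _ hkl => hsep (y k) (hmem _ (hymem k)).2 (y l) (hmem _ (hymem l)).2 (fun h => hkl (hyinj h)))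
    (fun k _ => by rw [dist_comm, dist_zero_right]; exact (hmem _ (hymem k)).1.le)
  have hre : ∑ z ∈ t', ‖z‖⁻¹ ^ 6 = ∑ k : Fin t'.card, (dist (0 : E3) (y k))⁻¹ ^ 6 := by
    have h1 : ∑ k : Fin t'.card, (dist (0 : E3) (y k))⁻¹ ^ 6 = ∑ z : t', (dist (0 : E3) (z : E3))⁻¹ ^ 6 := by
      rw [hy]
      exact (Fintype.sum_equiv t'.equivFin.symm (fun k => (dist (0 : E3) ((t'.equivFin.symm k : t') : E3))⁻¹ ^ 6)
        (fun z => (dist (0 : E3) (z : E3))⁻¹ ^ 6) (fun _ => rfl))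
    rw [h1, Finset.sum_coe_sort t' (fun z => (dist (0 : E3) z)⁻¹ ^ 6)]
    exact Finset.sum_congr rfl fun z _ => by rw [dist_comm, dist_zero_right]
  rw [hre]
  exact h2

/-- For `‖z‖ ≥ δ > 0`: `‖V_LJ(‖z‖)‖ₑ ≤ (δ⁻⁶/12 + 1/6)·‖z‖⁻⁶` (`r⁻¹² = r⁻⁶·r⁻⁶ ≤ δ⁻⁶ r⁻⁶`). [folklore] -/
theorem enorm_lennardJones_norm_le (hδ : 0 < δ) {z : E3} (hz : δ ≤ ‖z‖) :
    ‖lennardJones ‖z‖‖ₑ ≤ ENNReal.ofReal ((δ⁻¹ ^ 6 / 12 + 1 / 6) * ‖z‖⁻¹ ^ 6) := by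
  have hr0 : 0 < ‖z‖ := hδ.trans_le hz
  have hu0 : 0 ≤ ‖z‖⁻¹ ^ 6 := by positivity
  have huη : ‖z‖⁻¹ ^ 6 ≤ δ⁻¹ ^ 6 := pow_le_pow_left₀ (inv_nonneg.2 hr0.le) (inv_anti₀ hδ hz) 6
  have h12 : ‖z‖⁻¹ ^ 12 = ‖z‖⁻¹ ^ 6 * ‖z‖⁻¹ ^ 6 := by ring
  have huu : ‖z‖⁻¹ ^ 6 * ‖z‖⁻¹ ^ 6 ≤ δ⁻¹ ^ 6 * ‖z‖⁻¹ ^ 6 := mul_le_mul_of_nonneg_right huη hu0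
  rw [Real.enorm_eq_ofReal_abs]
  refine ENNReal.ofReal_le_ofReal (abs_le.mpr ⟨?_, ?_⟩)
  · unfold lennardJones; rw [h12]; nlinarith
  · unfold lennardJones; rw [h12]; nlinarith

/-- On a rooted `δ`-hard-core configuration the Lennard-Jones field `z ↦ V_LJ(‖z‖)` is integrable. [folklore] -/
theorem integrable_lennardJones_of_isRootedHardCore (hδ : 0 < δ) (hν : IsRootedHardCore δ ν) :
    Integrable (fun z : E3 => lennardJones ‖z‖) ν := by
  obtain ⟨hp, hm, -⟩ := rootEnergy_eq_parts hδ hν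
  obtain ⟨hpm, hmm⟩ := measurable_ofReal_lennardJones_parts
  have hLJm : Measurable fun y : E3 => lennardJones ‖y‖ := by
    have : Measurable lennardJones := by unfold lennardJones; fun_prop
    exact this.comp measurable_norm
  refine ⟨hLJm.aestronglyMeasurable, ?_⟩
  show ∫⁻ y, ‖lennardJones ‖y‖‖ₑ ∂ν < ∞
  calc ∫⁻ y, ‖lennardJones ‖y‖‖ₑ ∂ν
      ≤ ∫⁻ y, (ENNReal.ofReal (lennardJones ‖y‖) + ENNReal.ofReal (-lennardJones ‖y‖)) ∂ν := lintegral_mono fun y => by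
        rw [Real.enorm_eq_ofReal_abs]
        rcases le_total 0 (lennardJones ‖y‖) with h | h
        · rw [abs_of_nonneg h]; exact le_self_add
        · rw [abs_of_nonpos h]; exact le_add_self
    _ = (∫⁻ y, ENNReal.ofReal (lennardJones ‖y‖) ∂ν) + ∫⁻ y, ENNReal.ofReal (-lennardJones ‖y‖) ∂ν := lintegral_add_left hpm _
    _ < ∞ := ENNReal.add_lt_top.2 ⟨hp.trans_lt ENNReal.ofReal_lt_top, hm.trans_lt ENNReal.ofReal_lt_top⟩

/-- **Truncation of the root energy.**  For a rooted `δ`-hard-core `ν` and `R ≥ δ`: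
`|rootEnergy V_LJ ν − ½ ∫_{B̄_R(0)} V_LJ(‖z‖) dν| ≤ ½ (δ⁻⁶/12 + 1/6)·250·δ⁻³·R⁻³`. [folklore] -/
theorem abs_rootEnergy_sub_truncated_le (hδ : 0 < δ) (hν : IsRootedHardCore δ ν) {R : ℝ} (hR : δ ≤ R) :
    |rootEnergy lennardJones ν - (∫ z in closedBall (0 : E3) R, lennardJones ‖z‖ ∂ν) / 2| ≤
      (δ⁻¹ ^ 6 / 12 + 1 / 6) * (250 * δ⁻¹ ^ 3 * R⁻¹ ^ 3) / 2 := by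
  have hint := integrable_lennardJones_of_isRootedHardCore hδ hν
  have htail := setLIntegral_invPow_six_compl_le hδ hν hR
  have hR0 : 0 < R := hδ.trans_le hR
  obtain ⟨S, -, hsep, hνS⟩ := id hν
  rw [rootEnergy_def, ← integral_add_compl (measurableSet_closedBall (x := (0 : E3)) (ε := R)) hint]
  have hc : 0 ≤ δ⁻¹ ^ 6 / 12 + 1 / 6 := by positivity
  -- the far part is bounded through its `ℝ≥0∞` norm integral
  have hfar : ‖∫ z in (closedBall (0 : E3) R)ᶜ, lennardJones ‖z‖ ∂ν‖ ≤ (δ⁻¹ ^ 6 / 12 + 1 / 6) * (250 * δ⁻¹ ^ 3 * R⁻¹ ^ 3) := by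
    refine (norm_integral_le_lintegral_norm _).trans ?_
    simp_rw [ofReal_norm]
    have hle : ∫⁻ z in (closedBall (0 : E3) R)ᶜ, ‖lennardJones ‖z‖‖ₑ ∂ν ≤
        ENNReal.ofReal (δ⁻¹ ^ 6 / 12 + 1 / 6) * ∫⁻ z in (closedBall (0 : E3) R)ᶜ, ENNReal.ofReal (‖z‖⁻¹ ^ 6) ∂ν := by
      rw [← lintegral_const_mul' _ _ ENNReal.ofReal_ne_top]
      refine lintegral_mono_ae ((ae_restrict_iff' measurableSet_closedBall.compl).mpr (ae_of_all _ fun z hz => ?_))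
      have hz' : R < ‖z‖ := by simpa [mem_closedBall, dist_zero_right] using hz
      rw [← ENNReal.ofReal_mul hc]
      exact enorm_lennardJones_norm_le hδ (hR.trans hz'.le)
    calc (∫⁻ z in (closedBall (0 : E3) R)ᶜ, ‖lennardJones ‖z‖‖ₑ ∂ν).toReal
        ≤ (ENNReal.ofReal (δ⁻¹ ^ 6 / 12 + 1 / 6) * ENNReal.ofReal (250 * δ⁻¹ ^ 3 * R⁻¹ ^ 3)).toReal :=
          ENNReal.toReal_mono (ENNReal.mul_ne_top ENNReal.ofReal_ne_top ENNReal.ofReal_ne_top) (hle.trans (by gcongr))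
      _ = (δ⁻¹ ^ 6 / 12 + 1 / 6) * (250 * δ⁻¹ ^ 3 * R⁻¹ ^ 3) := by
          rw [ENNReal.toReal_mul, ENNReal.toReal_ofReal hc, ENNReal.toReal_ofReal (by positivity)]
  rw [Real.norm_eq_abs] at hfar
  have : ((∫ z in closedBall (0 : E3) R, lennardJones ‖z‖ ∂ν) + ∫ z in (closedBall (0 : E3) R)ᶜ, lennardJones ‖z‖ ∂ν) / 2 -
      (∫ z in closedBall (0 : E3) R, lennardJones ‖z‖ ∂ν) / 2 = (∫ z in (closedBall (0 : E3) R)ᶜ, lennardJones ‖z‖ ∂ν) / 2 := by ring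
  rw [this, abs_div, abs_two]
  linarith

end Summit.AtomisticToContinuum.Crystallization.Theorems.FrustratedLawDichotomyTransportPriceTail

end
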